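import Summits.CriticalPhenomena.PercolationContinuityZ3.Theses.PercNearOneGluing
import Literature.Probability.Percolation.PercolationEvents
import HarnessLib.Audit
import Summits.CriticalPhenomena.PercolationContinuityZ3.Theorems.PercNearOneGluingNearOneGluingVariants2415
import Summits.CriticalPhenomena.PercolationContinuityZ3.Theorems.PercNearOneGluingNearOneGluingVariants2525

/-! TTRL-lite variant V2461 of stmt-CriticalPhenomena-4574

(`stub_shorteningStep` of line `kn_shortening_induction`, move `small_case+small_case`:
`A.card ≤ 3` and `n ≤ 5`).  Kozma–Nitzan's shortening step (arXiv:2401.12397, Conjecture 6,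
measured against the minimiser `a₀` of the uncontracted graph) on at most five vertices with at
most three relays.  It is the union of two already-landed sibling variants: `A.card ≤ 2` (any `n`,
`stub_shorteningStep_var2415`) and `A.card = 3`, `n ≤ 5` (`stub_shorteningStep_var2525`); the proof
is the case split `A.card ≤ 2 ∨ A.card = 3`.  No new definitions, no named facts; the displayed
induction hypothesis is only passed through. -/

namespace Summit.CriticalPhenomena.PercolationContinuityZ3.Theorems

open MeasureTheory Set Literature.Probability.LatticeModels Literature.Probability.Percolation
open scoped Classical BigOperators

/-- TTRL-lite variant V2461 of `stub_shorteningStep` (stmt-CriticalPhenomena-4574, Kozma–Nitzan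
Conjecture 6 against the old minimiser, with Lemma 13's induction hypothesis displayed): for the
glued measure `μ₁ = prodBernoulli (w[s(v,x) ↦ 1])`,
`μ₁(⋃ a ∈ A, v ↔ a) · μ₁(a₀ ↔ b) ≤ μ₁(v ↔ b)` whenever `A.card ≤ 3` and `n ≤ 5`.
Case split on `A.card ≤ 2` (sibling `stub_shorteningStep_var2415`) versus `A.card = 3`
(sibling `stub_shorteningStep_var2525`, which uses `n ≤ 5`). -/
theorem stub_shorteningStep_var2461 : ∀ (n : ℕ) (w : Sym2 (Fin n) → unitInterval) (A : Finset (Fin n)) (b v x a₀ : Fin n), A.card ≤ 3 → n ≤ 5 → v ∉ A → v ≠ x → w s(v, x) = 0 → a₀ ∈ A → (∀ a ∈ A, (prodBernoulli w).real (openConn a₀ b) ≤ (prodBernoulli w).real (openConn a b)) → (∀ w' : Sym2 (Fin n) → unitInterval, (∀ e, w e = 0 → w' e = 0) → ∀ (A' : Finset (Fin n)) (o' b' : Fin n) (t : ℝ), (∀ a ∈ A', t ≤ (prodBernoulli w').real (openConn a b')) → (prodBernoulli w').real (⋃ a ∈ A', openConn o' a) * t ≤ (prodBernoulli w').real (openConn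 o' b')) → (prodBernoulli (Function.update w s(v, x) 1)).real (⋃ a ∈ A, openConn v a) * (prodBernoulli (Function.update w s(v, x) 1)).real (openConn a₀ b) ≤ (prodBernoulli (Function.update w s(v, x) 1)).real (openConn v b) := by
  intro n w A b v x a₀ hcard hn
  rcases Nat.lt_or_ge A.card 3 with h2 | h3
  · exact stub_shorteningStep_var2415 n w A b v x a₀ (by omega)
  · exact stub_shorteningStep_var2525 n w A b v x a₀ hn (by omega)

end Summit.CriticalPhenomena.PercolationContinuityZ3.Theorems
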